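import Summits.KontsevichZagierPeriods.KontsevichZagierPeriods.Theorems.HeckeMultiplicityOneManinStokesTileGeometry

/-!
# `ManinStokes` (stmt-KontsevichZagierPeriods-5277): the edge `C = {1/2 + it}` of the `(2,3,∞)`-tile under `j`

Support file (prover-owned, `--supports stmt-KontsevichZagierPeriods-5277`), companion of
`HeckeMultiplicityOneManinStokesTileGeometry.lean`: the third edge of the tile
`τ₀ = {0 < re z < 1/2, |z| > 1}`, the vertical line `C = {1/2 + it | t ≥ √3/2}` from `1 + ρ` to the
cusp. On it `j` is real (`kleinJ_im_eq_zero`, `2 re = 1`), and `t ↦ re j(1/2 + it)` is a strictly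
decreasing bijection of `[√3/2, ∞)` onto `(−∞, 0]`: injective by `kleinJ_injOn_halfFd`, `0` at
`t = √3/2` (`j(1 + ρ) = j(ρ) = 0`), and `re j(1/2 + it) < 790 − 6t` for `t ≥ 2` from the cusp expansion
`j = 1/q + 744 + O(q)` with `q = −e^{−2πt}` (`norm_E₄_cube_div_discriminant_sub_sub_le`).

References: J.-P. Serre, *A Course in Arithmetic* (1973), VII §3.3; D. A. Cox, *Primes of the form
x² + ny²* (2013), §11.A. No definitions, no named facts.
-/

noncomputable section

open scoped MatrixGroups ModularForm Modular
open CongruenceSubgroup Complex Set Filter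
open UpperHalfPlane hiding I
open Literature.NumberTheory.EllipticCurves Literature.NumberTheory.EllipticCurves.ModularForms

namespace Summit.KontsevichZagierPeriods.HeckeMultiplicityOne.ManinStokes

/-! ### The edge `C`: the vertical line `t ↦ 1/2 + it`, `t ≥ √3/2`, from `1 + ρ` to `∞` -/

/-- `1/2 + it` has positive imaginary part for `t > 0`. [folklore] -/
theorem im_half_add_mul_I_pos {t : ℝ} (ht : 0 < t) : 0 < ((1 / 2 : ℂ) + t * I).im := by
  simpa using ht

/-- The underlying complex number of the point `1/2 + it` of `ℍ`. [folklore] -/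
theorem coe_ofComplex_half {t : ℝ} (ht : 0 < t) :
    ((ofComplex ((1 / 2 : ℂ) + t * I) : ℍ) : ℂ) = (1 / 2 : ℂ) + t * I :=
  coe_ofComplex (im_half_add_mul_I_pos ht)

/-- `re (1/2 + it) = 1/2`. [folklore] -/
theorem re_ofComplex_half {t : ℝ} (ht : 0 < t) : (ofComplex ((1 / 2 : ℂ) + t * I) : ℍ).re = 1 / 2 := by
  rw [← UpperHalfPlane.coe_re, coe_ofComplex_half ht]; simp

/-- `im (1/2 + it) = t`. [folklore] -/
theorem im_ofComplex_half {t : ℝ} (ht : 0 < t) : (ofComplex ((1 / 2 : ℂ) + t * I) : ℍ).im = t := by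
  rw [← UpperHalfPlane.coe_im, coe_ofComplex_half ht]; simp

/-- For `t ≥ √3/2` the point `1/2 + it` lies in the closed half fundamental domain. [folklore] -/
theorem ofComplex_half_mem_halfFd {t : ℝ} (ht : Real.sqrt 3 / 2 ≤ t) :
    (ofComplex ((1 / 2 : ℂ) + t * I) : ℍ) ∈ {z : ℍ | z ∈ 𝒟 ∧ 0 ≤ z.re} := by
  have h3 : Real.sqrt 3 ^ 2 = 3 := Real.sq_sqrt (by norm_num)
  have ht0 : 0 < t := lt_of_lt_of_le (by positivity) ht
  have htt : 3 / 4 ≤ t * t := by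
    have := mul_self_le_mul_self (by positivity : (0 : ℝ) ≤ Real.sqrt 3 / 2) ht
    nlinarith [h3]
  refine ⟨⟨?_, ?_⟩, ?_⟩
  · rw [coe_ofComplex_half ht0, Complex.normSq_apply]
    simp
    nlinarith
  · rw [re_ofComplex_half ht0]; norm_num
  · rw [re_ofComplex_half ht0]; norm_num

/-- `j(1/2 + it)` is real (`2 re = 1 ∈ ℤ`, `kleinJ_im_eq_zero`). [folklore] -/
theorem kleinJ_ofComplex_half_im {t : ℝ} (ht : 0 < t) : (kleinJ (ofComplex ((1 / 2 : ℂ) + t * I))).im = 0 :=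
  kleinJ_im_eq_zero _ (k := 1) (by rw [re_ofComplex_half ht]; norm_num)

/-- `1/2 + i√3/2 = 1 + ρ = T·ρ`. [folklore] -/
theorem ofComplex_half_sqrt_three : (ofComplex ((1 / 2 : ℂ) + (Real.sqrt 3 / 2 : ℝ) * I) : ℍ) =
    ModularGroup.T • UpperHalfPlane.ρ := by
  apply UpperHalfPlane.ext
  rw [coe_ofComplex_half (by positivity), UpperHalfPlane.modular_T_smul, UpperHalfPlane.coe_vadd]
  apply Complex.ext
  · simp [UpperHalfPlane.ρ]; norm_num
  · simp [UpperHalfPlane.ρ]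

/-- `re j(1/2 + i√3/2) = 0`. [folklore] -/
theorem kleinJ_half_sqrt_three_re : (kleinJ (ofComplex ((1 / 2 : ℂ) + (Real.sqrt 3 / 2 : ℝ) * I))).re = 0 := by
  rw [ofComplex_half_sqrt_three, kleinJ_smul, kleinJ_rho]; simp

/-- `t ↦ j(1/2 + it)` is continuous on `(0, ∞)`. [folklore] -/
theorem continuousOn_kleinJ_ofComplex_half :
    ContinuousOn (fun t : ℝ => kleinJ (ofComplex ((1 / 2 : ℂ) + t * I))) (Ioi 0) := by
  have h1 : ContinuousOn (kleinJ ∘ ofComplex) {z : ℂ | 0 < z.im} :=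
    (UpperHalfPlane.mdifferentiable_iff.mp mdifferentiable_kleinJ).continuousOn
  refine h1.comp (by fun_prop) fun t ht => ?_
  exact im_half_add_mul_I_pos ht

/-- **`t ↦ re j(1/2 + it)` is injective on `[√3/2, ∞)`.** [folklore] -/
theorem injOn_kleinJ_ofComplex_half_re :
    InjOn (fun t : ℝ => (kleinJ (ofComplex ((1 / 2 : ℂ) + t * I))).re) (Ici (Real.sqrt 3 / 2)) := by
  intro t ht t' ht' h
  have ht0 : 0 < t := lt_of_lt_of_le (by positivity) (show Real.sqrt 3 / 2 ≤ t from ht)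
  have ht0' : 0 < t' := lt_of_lt_of_le (by positivity) (show Real.sqrt 3 / 2 ≤ t' from ht')
  have hj : kleinJ (ofComplex ((1 / 2 : ℂ) + t * I)) = kleinJ (ofComplex ((1 / 2 : ℂ) + t' * I)) :=
    Complex.ext h (by rw [kleinJ_ofComplex_half_im ht0, kleinJ_ofComplex_half_im ht0'])
  have hpt := kleinJ_injOn_halfFd (ofComplex_half_mem_halfFd ht) (ofComplex_half_mem_halfFd ht') hj
  rw [← im_ofComplex_half ht0, ← im_ofComplex_half ht0', hpt]

/-- On the line `re τ = 1/2` the nome is the negative real number `−e^{−2πt}`. [folklore] -/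
theorem qParam_ofComplex_half {t : ℝ} (ht : 0 < t) :
    Function.Periodic.qParam 1 ((ofComplex ((1 / 2 : ℂ) + t * I) : ℍ) : ℂ) =
      -(Real.exp (-(2 * Real.pi * t)) : ℂ) := by
  rw [Function.Periodic.qParam, coe_ofComplex_half ht, Complex.ofReal_exp,
    show (2 * (Real.pi : ℂ) * I * ((1 / 2 : ℂ) + t * I) / ((1 : ℝ) : ℂ) : ℂ) =
      (Real.pi : ℂ) * I + ((-(2 * Real.pi * t) : ℝ) : ℂ) by
        push_cast; ring_nf; rw [Complex.I_sq]; ring,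
    Complex.exp_add, Complex.exp_pi_mul_I]
  ring

/-- **`re j(1/2 + it) → −∞`**, quantitatively: `re j(1/2 + it) < 790 − 6t` for `t ≥ 2`
(`j = 1/q + 744 + O(q)` with `1/q = −e^{2πt}`). [folklore] -/
theorem kleinJ_ofComplex_half_re_lt {t : ℝ} (ht : 2 ≤ t) :
    (kleinJ (ofComplex ((1 / 2 : ℂ) + t * I))).re < 790 - 6 * t := by
  have ht0 : 0 < t := by linarith
  set r : ℝ := Real.exp (-(2 * Real.pi * t)) with hr
  have hr0 : 0 < r := Real.exp_pos _
  have hrle : r ≤ 1 / 10 ^ 4 := by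
    refine le_trans (Real.exp_le_exp.mpr ?_) exp_neg_four_pi_le
    have := Real.pi_pos
    nlinarith
  have hq := qParam_ofComplex_half ht0
  have hnorm : ‖Function.Periodic.qParam 1 ((ofComplex ((1 / 2 : ℂ) + t * I) : ℍ) : ℂ)‖ = r := by
    rw [hq, norm_neg, Complex.norm_real, Real.norm_of_nonneg hr0.le]
  have hest := norm_E₄_cube_div_discriminant_sub_sub_le (ofComplex ((1 / 2 : ℂ) + t * I))
    (by rw [hnorm]; exact hrle)
  rw [hnorm, hq] at hest
  change ‖kleinJ (ofComplex ((1 / 2 : ℂ) + t * I)) - _ - 744‖ ≤ _ at hest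
  set J := kleinJ (ofComplex ((1 / 2 : ℂ) + t * I)) with hJ
  have hre : |(J - (-(r : ℂ))⁻¹ - 744).re| ≤ 400000 * r := (Complex.abs_re_le_norm _).trans hest
  have hre' : (J - (-(r : ℂ))⁻¹ - 744).re = J.re + r⁻¹ - 744 := by
    rw [← Complex.ofReal_neg, ← Complex.ofReal_inv]
    simp [inv_neg]
  rw [hre'] at hre
  have h2 : J.re + r⁻¹ - 744 ≤ 400000 * r := (abs_le.mp hre).2
  have h3 : 400000 * r ≤ 40 := by linarith
  have h4 : 6 * t < r⁻¹ := by
    rw [hr, ← Real.exp_neg, neg_neg]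
    have h5 := Real.add_one_le_exp (2 * Real.pi * t)
    have h6 : 6 * t < 2 * Real.pi * t := by
      have := Real.pi_gt_three
      nlinarith
    linarith
  linarith

/-- **`t ↦ re j(1/2 + it)` is strictly decreasing on `[√3/2, ∞)`** (from `0` towards `−∞`). [folklore] -/
theorem strictAntiOn_kleinJ_ofComplex_half_re :
    StrictAntiOn (fun t : ℝ => (kleinJ (ofComplex ((1 / 2 : ℂ) + t * I))).re) (Ici (Real.sqrt 3 / 2)) := by
  intro s hs t ht hst
  have hs0 : Real.sqrt 3 / 2 ≤ s := hs
  set B : ℝ := max t 200 with hB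
  have hB2 : (2 : ℝ) ≤ B := le_trans (by norm_num) (le_max_right _ _)
  have h32 : Real.sqrt 3 / 2 < 2 := by
    have : Real.sqrt 3 < 2 := by
      rw [show (2 : ℝ) = Real.sqrt 4 by rw [show (4 : ℝ) = 2 ^ 2 by norm_num, Real.sqrt_sq (by norm_num)]]
      exact Real.sqrt_lt_sqrt (by norm_num) (by norm_num)
    linarith
  have hanti : StrictAntiOn (fun t : ℝ => (kleinJ (ofComplex ((1 / 2 : ℂ) + t * I))).re)
      (Icc (Real.sqrt 3 / 2) B) := by
    refine ContinuousOn.strictAntiOn_of_injOn_Icc (by linarith) ?_ ?_ ?_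
    · rw [kleinJ_half_sqrt_three_re]
      have := kleinJ_ofComplex_half_re_lt hB2
      linarith [le_max_right t 200]
    · exact (Complex.continuous_re.comp_continuousOn continuousOn_kleinJ_ofComplex_half).mono
        fun x hx => lt_of_lt_of_le (by positivity) hx.1
    · exact injOn_kleinJ_ofComplex_half_re.mono fun x hx => hx.1
  exact hanti ⟨hs0, (le_of_lt hst).trans (le_max_left _ _)⟩ ⟨hs0.trans hst.le, le_max_left _ _⟩ hst

/-- **The line `C` covers `(−∞, 0]`**: every `u ≤ 0` is `re j(1/2 + it)` for some (unique) `t ≥ √3/2`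
(intermediate value theorem). [folklore] -/
theorem exists_kleinJ_ofComplex_half_re_eq {u : ℝ} (hu : u ≤ 0) :
    ∃ t ∈ Ici (Real.sqrt 3 / 2), (kleinJ (ofComplex ((1 / 2 : ℂ) + t * I))).re = u := by
  set B : ℝ := max ((790 - u) / 6) 200 with hB
  have hB2 : (2 : ℝ) ≤ B := le_trans (by norm_num) (le_max_right _ _)
  have h32 : Real.sqrt 3 / 2 < 2 := by
    have : Real.sqrt 3 < 2 := by
      rw [show (2 : ℝ) = Real.sqrt 4 by rw [show (4 : ℝ) = 2 ^ 2 by norm_num, Real.sqrt_sq (by norm_num)]]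
      exact Real.sqrt_lt_sqrt (by norm_num) (by norm_num)
    linarith
  have hcont : ContinuousOn (fun t : ℝ => (kleinJ (ofComplex ((1 / 2 : ℂ) + t * I))).re)
      (Icc (Real.sqrt 3 / 2) B) :=
    (Complex.continuous_re.comp_continuousOn continuousOn_kleinJ_ofComplex_half).mono
      fun x hx => lt_of_lt_of_le (by positivity) hx.1
  have hlt := kleinJ_ofComplex_half_re_lt hB2
  have hmem : u ∈ Icc ((kleinJ (ofComplex ((1 / 2 : ℂ) + B * I))).re)
      ((kleinJ (ofComplex ((1 / 2 : ℂ) + (Real.sqrt 3 / 2 : ℝ) * I))).re) := by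
    rw [kleinJ_half_sqrt_three_re]
    refine ⟨?_, hu⟩
    have : (790 - u) / 6 ≤ B := le_max_left _ _
    linarith
  obtain ⟨t, ht, htu⟩ := intermediate_value_Icc' (by linarith) hcont hmem
  exact ⟨t, ht.1, htu⟩

end Summit.KontsevichZagierPeriods.HeckeMultiplicityOne.ManinStokes
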